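import Mathlib
import Summits.PneNP.PneNP.Theorems.ClusUniversalCertificateCoordNested
import Summits.PneNP.PneNP.Theorems.ClusUniversalCertificateCoordThresholds

/-!
# Route ClusUniversalCertificate, crux `UniversalCertAll` — path `coord`: the ONE-COORDINATE EXCESS formula (b = 1)

Support file for `stmt-PneNP-19683` (cell pnp-ideate, route `ClusUniversalCertificate`, rung F-N1; path `coord` of pnp-ideate-p1, ROUND-7 §4b/§6
ask H2 «one-coordinate excess»; objects of record `…CoordDefs.lean` p516754 / `…CoordBlkDefs.lean` p519312, namespace `…Theorems.ClusCoord`).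

For a block `k = {i}` of size `1`, a point `y ∈ Y` at level `a = y i`, and the slices `S_c := π({z ∈ Y : z i = c})` one block down:

  `dim_Y(y) = dim_{S_a}(π y) + [some MAXIMAL flat of S_a through π y has a translate inside S_{a+1}]`

(`dim_eq_sliceDim_add_excess`; dimensions as `M − acodim`, `M' − acodim`).  Ingredients: the zero-extension `zext : 𝔽₂^{M'} →ₗ 𝔽₂^M`
(`delBlk ∘ zext = id`, block `k` of `zext x` vanishes), by which flats of a slice LIFT to horizontal flats of `Y` (`≥`, `sliceDim_le_dim`) and —
given a translate of a maximal slice flat inside the other slice — to a flat one dimension higher (`dim_ge_of_liftsAcross`); conversely the level part of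
an optimal flat of `Y` projects injectively into the slice and has codimension `≤ 1` in it, with equality forcing a crossing direction and hence a
translate of a maximal slice flat inside the other slice (`≤`, via the landed `ClusCoordGauge.acodim_member_le` with `H = 0`).
FRONTIER rung F-N1; the b = 1 case of p1's excess calculus — the conjecture (T1 / `stub_peelZeroRare5`) and the crux are OPEN; nothing here bears
on P vs NP.
-/

set_option linter.dupNamespace false -- `Summit.PneNP.PneNP.…`: summit = sub-problem name (D-0017 single-conjunct layout)

namespace Summit.PneNP.PneNP.Theorems.ClusCoordExcess

open Finset
open Summit.PneNP.PneNP.Theorems.ClusCoord (acodim bsize kemb)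
open Summit.PneNP.PneNP.Theorems.ClusCoordBookBlk (blk_kemb_ne exists_kemb_eq)
open Summit.PneNP.PneNP.Theorems.ClusCoordZeroFree (blockProj blockProj_apply blockProj_blockProj_self)
open Summit.PneNP.PneNP.Theorems.ClusCoordGauge (delBlk delBlk_apply gaugeMap gaugeMember exists_optimal acodim_member_le
  finrank_map_gaugeMap_le eq_zero_of_blockProj_of_delBlk)
open Summit.PneNP.PneNP.Theorems.ClusCoordSliceZeroFree (gaugeMap_zero)
open Summit.PneNP.PneNP.Theorems.ClusCoordNested (eq_of_bsize_one)

variable {M M' n : ℕ}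

/-! ## The zero-extension one block up -/

/-- The zero-extension `𝔽₂^{M'} → 𝔽₂^M`: copy the coordinates outside block `k`, put `0` on block `k`. -/
noncomputable def zext (blk : Fin M → Fin n) (k : Fin n) (M' : ℕ) (h : (univ.filter fun i => blk i ≠ k).card = M') :
    (Fin M' → ZMod 2) →ₗ[ZMod 2] (Fin M → ZMod 2) where
  toFun x := fun j => if hj : blk j ≠ k then x (Classical.choose (exists_kemb_eq blk k h j hj)) else 0
  map_add' u v := by
    funext j
    simp only [Pi.add_apply]
    split_ifs <;> simp
  map_smul' c v := by
    funext j
    simp only [Pi.smul_apply, smul_eq_mul, RingHom.id_apply]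
    split_ifs <;> simp

/-- `π ∘ zext = id`. -/
theorem delBlk_zext (blk : Fin M → Fin n) (k : Fin n) (M' : ℕ) (h : (univ.filter fun i => blk i ≠ k).card = M')
    (x : Fin M' → ZMod 2) : delBlk blk k M' h (zext blk k M' h x) = x := by
  funext l
  rw [delBlk_apply]
  have hl : blk (kemb blk k M' h l) ≠ k := blk_kemb_ne blk k h l
  change (if hj : blk (kemb blk k M' h l) ≠ k then x (Classical.choose (exists_kemb_eq blk k h _ hj)) else 0) = x l
  rw [dif_pos hl]
  congr 1
  exact (kemb blk k M' h).injective (Classical.choose_spec (exists_kemb_eq blk k h _ hl))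

/-- Block `k` of a zero-extension vanishes. -/
theorem zext_apply_of_blk_eq (blk : Fin M → Fin n) (k : Fin n) (M' : ℕ) (h : (univ.filter fun i => blk i ≠ k).card = M')
    (x : Fin M' → ZMod 2) (j : Fin M) (hj : blk j = k) : zext blk k M' h x j = 0 := by
  change (if hj : blk j ≠ k then x (Classical.choose (exists_kemb_eq blk k h j hj)) else 0) = 0
  rw [dif_neg (not_not.mpr hj)]

/-- `zext` is injective. -/
theorem zext_injective (blk : Fin M → Fin n) (k : Fin n) (M' : ℕ) (h : (univ.filter fun i => blk i ≠ k).card = M') :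
    Function.Injective (zext blk k M' h) := fun a b hab => by
  have := congrArg (delBlk blk k M' h) hab
  rwa [delBlk_zext, delBlk_zext] at this

/-! ## Size-1 blocks: a point is its projection plus its `i`-th coordinate -/

/-- For a size-1 block `{i}`: two points with the same projection and the same `i`-th coordinate are equal. -/
theorem eq_of_delBlk_eq_of_apply_eq (blk : Fin M → Fin n) (k : Fin n) (M' : ℕ) (h : (univ.filter fun i => blk i ≠ k).card = M')
    (i : Fin M) (hi : blk i = k) (hb : bsize blk k = 1) {z z' : Fin M → ZMod 2}
    (hp : delBlk blk k M' h z = delBlk blk k M' h z') (hc : z i = z' i) : z = z' := by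
  have h2 : delBlk blk k M' h (z - z') = 0 := by rw [map_sub, hp, sub_self]
  have h1 : blockProj blk k (z - z') = 0 := by
    funext j
    rw [blockProj_apply]
    split_ifs with hj
    · rw [eq_of_bsize_one blk k hb i hi j hj, Pi.sub_apply, hc, sub_self]; rfl
    · rfl
  exact sub_eq_zero.mp (eq_zero_of_blockProj_of_delBlk blk k M' h _ h1 h2)

/-! ## Slices and the excess indicator -/

/-- The slice at level `c` of coordinate `i`, one block down. -/
noncomputable def sliceAt (blk : Fin M → Fin n) (Y : Finset (Fin M → ZMod 2)) (k : Fin n) (M' : ℕ)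
    (h : (univ.filter fun i => blk i ≠ k).card = M') (i : Fin M) (c : ZMod 2) : Finset (Fin M' → ZMod 2) :=
  (Y.filter fun z => z i = c).image (delBlk blk k M' h)

/-- `x ∈ S_c` iff the point with projection `x` and `i`-th coordinate `c` lies in `Y`:
here phrased as the existence of such a point of `Y`. -/
theorem mem_sliceAt (blk : Fin M → Fin n) (Y : Finset (Fin M → ZMod 2)) (k : Fin n) (M' : ℕ)
    (h : (univ.filter fun i => blk i ≠ k).card = M') (i : Fin M) (c : ZMod 2) (x : Fin M' → ZMod 2) :
    x ∈ sliceAt blk Y k M' h i c ↔ ∃ z ∈ Y, z i = c ∧ delBlk blk k M' h z = x := by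
  unfold sliceAt
  rw [Finset.mem_image]
  constructor
  · rintro ⟨z, hz, hzx⟩; exact ⟨z, (Finset.mem_filter.1 hz).1, (Finset.mem_filter.1 hz).2, hzx⟩
  · rintro ⟨z, hz, hzc, hzx⟩; exact ⟨z, Finset.mem_filter.2 ⟨hz, hzc⟩, hzx⟩

/-- `y` LIFTS ACROSS: some maximal flat of the slice of `y` through `π y` has a translate inside the other slice. -/
def LiftsAcross (blk : Fin M → Fin n) (Y : Finset (Fin M → ZMod 2)) (k : Fin n) (M' : ℕ)
    (h : (univ.filter fun i => blk i ≠ k).card = M') (i : Fin M) (y : Fin M → ZMod 2) : Prop :=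
  ∃ B : AffineSubspace (ZMod 2) (Fin M' → ZMod 2), delBlk blk k M' h y ∈ B ∧ (∀ x ∈ B, x ∈ sliceAt blk Y k M' h i (y i)) ∧
    M' ≤ Module.finrank (ZMod 2) B.direction + acodim M' (sliceAt blk Y k M' h i (y i)) (delBlk blk k M' h y) ∧
    ∃ t : Fin M' → ZMod 2, ∀ x ∈ B, x + t ∈ sliceAt blk Y k M' h i (y i + 1)

/-! ## Lifting slice flats: the lower bounds -/

/-- The horizontal lift of a flat of the slice through `π y`: `y + zext(B.direction)`; its points lie in `Y`. -/
theorem lift_mem (blk : Fin M → Fin n) (Y : Finset (Fin M → ZMod 2)) (k : Fin n) (M' : ℕ)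
    (h : (univ.filter fun i => blk i ≠ k).card = M') (i : Fin M) (hi : blk i = k) (hb : bsize blk k = 1)
    (y : Fin M → ZMod 2) (B : AffineSubspace (ZMod 2) (Fin M' → ZMod 2)) (hyB : delBlk blk k M' h y ∈ B)
    (hBS : ∀ x ∈ B, x ∈ sliceAt blk Y k M' h i (y i)) (d : Fin M' → ZMod 2) (hd : d ∈ B.direction) (c : ZMod 2)
    (t : Fin M' → ZMod 2) (ht : c = 0 ∨ ∀ x ∈ B, x + t ∈ sliceAt blk Y k M' h i (y i + 1)) :
    y + zext blk k M' h d + c • (zext blk k M' h t + Pi.single i 1) ∈ Y := by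
  -- the point of `Y` over `π y + d (+ t)` at the right level
  have hxB : delBlk blk k M' h y + d ∈ B := by
    have := AffineSubspace.vadd_mem_of_mem_direction hd hyB
    rwa [vadd_eq_add, add_comm] at this
  have h01 : ∀ e : ZMod 2, e = 0 ∨ e = 1 := by decide
  rcases h01 c with rfl | rfl
  · -- level `a`
    obtain ⟨z, hz, hzc, hzx⟩ := (mem_sliceAt blk Y k M' h i _ _).1 (hBS _ hxB)
    have : y + zext blk k M' h d + (0 : ZMod 2) • (zext blk k M' h t + Pi.single i 1) = z := by
      rw [zero_smul, add_zero]
      apply eq_of_delBlk_eq_of_apply_eq blk k M' h i hi hb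
      · rw [map_add, delBlk_zext, hzx]
      · rw [Pi.add_apply, zext_apply_of_blk_eq blk k M' h d i hi, add_zero, hzc]
    rw [this]; exact hz
  · -- level `a + 1`
    rcases ht with h0 | ht
    · exact absurd h0 one_ne_zero
    obtain ⟨z, hz, hzc, hzx⟩ := (mem_sliceAt blk Y k M' h i _ _).1 (ht _ hxB)
    have : y + zext blk k M' h d + (1 : ZMod 2) • (zext blk k M' h t + Pi.single i 1) = z := by
      rw [one_smul]
      apply eq_of_delBlk_eq_of_apply_eq blk k M' h i hi hb
      · rw [map_add, map_add, map_add, delBlk_zext, delBlk_zext, hzx]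
        have : delBlk blk k M' h (Pi.single i (1 : ZMod 2)) = 0 := by
          funext l
          rw [delBlk_apply]
          have hl : kemb blk k M' h l ≠ i := fun hli => blk_kemb_ne blk k h l (hli ▸ hi)
          simp [Pi.single_eq_of_ne hl]
        rw [this, add_zero]
      · rw [Pi.add_apply, Pi.add_apply, Pi.add_apply, zext_apply_of_blk_eq blk k M' h d i hi,
          zext_apply_of_blk_eq blk k M' h t i hi, Pi.single_eq_same, hzc]
        ring
    rw [this]; exact hz

/-- `≥`, horizontal part: `dim_Y(y) ≥ dim B` for every flat `B ∋ π y` inside the slice of `y`. -/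
theorem dim_ge_flat (blk : Fin M → Fin n) (Y : Finset (Fin M → ZMod 2)) (k : Fin n) (M' : ℕ)
    (h : (univ.filter fun i => blk i ≠ k).card = M') (i : Fin M) (hi : blk i = k) (hb : bsize blk k = 1)
    (y : Fin M → ZMod 2) (B : AffineSubspace (ZMod 2) (Fin M' → ZMod 2)) (hyB : delBlk blk k M' h y ∈ B)
    (hBS : ∀ x ∈ B, x ∈ sliceAt blk Y k M' h i (y i)) :
    acodim M Y y + Module.finrank (ZMod 2) B.direction ≤ M := by
  set D₀ : Submodule (ZMod 2) (Fin M → ZMod 2) := B.direction.map (zext blk k M' h) with hD₀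
  have hinj0 : Function.Injective ((zext blk k M' h) ∘ₗ B.direction.subtype) :=
    (zext_injective blk k M' h).comp B.direction.subtype_injective
  have hdimD₀ : Module.finrank (ZMod 2) D₀ = Module.finrank (ZMod 2) B.direction := by
    rw [hD₀, ← LinearMap.finrank_range_of_inj hinj0, LinearMap.range_comp, Submodule.range_subtype]
  have hle : acodim M Y y ≤ M - Module.finrank (ZMod 2) B.direction := by
    unfold acodim
    apply Nat.sInf_le
    refine ⟨AffineSubspace.mk' y D₀, AffineSubspace.self_mem_mk' _ _, ?_, ?_⟩
    · intro z hz
      rw [AffineSubspace.mem_mk', hD₀, Submodule.mem_map] at hz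
      obtain ⟨d, hd, hdz⟩ := hz
      have : z = y + zext blk k M' h d + (0 : ZMod 2) • (zext blk k M' h 0 + Pi.single i 1) := by
        rw [zero_smul, add_zero, hdz, vsub_eq_sub, add_sub_cancel]
      rw [this]
      exact lift_mem blk Y k M' h i hi hb y B hyB hBS d hd 0 0 (Or.inl rfl)
    · rw [AffineSubspace.direction_mk', hdimD₀]
      omega
  have hBle : Module.finrank (ZMod 2) B.direction ≤ M := by
    have := Submodule.finrank_le D₀
    rw [Module.finrank_fintype_fun_eq_card, Fintype.card_fin, hdimD₀] at this
    exact this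
  omega

/-- `≥`, crossing part: `dim_Y(y) ≥ dim B + 1` for every flat `B ∋ π y` inside the slice of `y` having a translate inside the other slice. -/
theorem dim_ge_flat_translate (blk : Fin M → Fin n) (Y : Finset (Fin M → ZMod 2)) (k : Fin n) (M' : ℕ)
    (h : (univ.filter fun i => blk i ≠ k).card = M') (i : Fin M) (hi : blk i = k) (hb : bsize blk k = 1)
    (y : Fin M → ZMod 2) (B : AffineSubspace (ZMod 2) (Fin M' → ZMod 2)) (hyB : delBlk blk k M' h y ∈ B)
    (hBS : ∀ x ∈ B, x ∈ sliceAt blk Y k M' h i (y i)) (t : Fin M' → ZMod 2)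
    (ht : ∀ x ∈ B, x + t ∈ sliceAt blk Y k M' h i (y i + 1)) :
    acodim M Y y + Module.finrank (ZMod 2) B.direction + 1 ≤ M := by
  set w : Fin M → ZMod 2 := zext blk k M' h t + Pi.single i 1 with hw
  set D₀ : Submodule (ZMod 2) (Fin M → ZMod 2) := B.direction.map (zext blk k M' h) with hD₀
  set D : Submodule (ZMod 2) (Fin M → ZMod 2) := D₀ ⊔ Submodule.span (ZMod 2) {w} with hD
  have hwi : w i = 1 := by
    rw [hw, Pi.add_apply, zext_apply_of_blk_eq blk k M' h t i hi, Pi.single_eq_same, zero_add]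
  have hD₀i : ∀ v ∈ D₀, v i = 0 := by
    rintro v ⟨d, -, rfl⟩
    exact zext_apply_of_blk_eq blk k M' h d i hi
  have hinj0 : Function.Injective ((zext blk k M' h) ∘ₗ B.direction.subtype) :=
    (zext_injective blk k M' h).comp B.direction.subtype_injective
  have hdimD₀ : Module.finrank (ZMod 2) D₀ = Module.finrank (ZMod 2) B.direction := by
    rw [hD₀, ← LinearMap.finrank_range_of_inj hinj0, LinearMap.range_comp, Submodule.range_subtype]
  have hw0 : w ≠ 0 := fun h0 => by rw [h0] at hwi; exact zero_ne_one hwi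
  have hinf : D₀ ⊓ Submodule.span (ZMod 2) {w} = ⊥ := by
    rw [Submodule.eq_bot_iff]
    intro v hv
    obtain ⟨hv1, hv2⟩ := Submodule.mem_inf.1 hv
    obtain ⟨c, rfl⟩ := Submodule.mem_span_singleton.1 hv2
    have h01 : ∀ c : ZMod 2, c = 0 ∨ c = 1 := by decide
    rcases h01 c with rfl | rfl
    · rw [zero_smul]
    · have := hD₀i _ hv1
      rw [one_smul, hwi] at this
      exact absurd this one_ne_zero
  have hdimD : Module.finrank (ZMod 2) D = Module.finrank (ZMod 2) B.direction + 1 := by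
    have hsup := Submodule.finrank_sup_add_finrank_inf_eq D₀ (Submodule.span (ZMod 2) {w})
    rw [hinf, finrank_bot, add_zero, finrank_span_singleton hw0, hdimD₀] at hsup
    rw [hD, hsup]
  have hle : acodim M Y y ≤ M - (Module.finrank (ZMod 2) B.direction + 1) := by
    unfold acodim
    apply Nat.sInf_le
    refine ⟨AffineSubspace.mk' y D, AffineSubspace.self_mem_mk' _ _, ?_, ?_⟩
    · intro z hz
      rw [AffineSubspace.mem_mk', hD, Submodule.mem_sup] at hz
      obtain ⟨u, hu, s, hs, hus⟩ := hz
      rw [hD₀, Submodule.mem_map] at hu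
      obtain ⟨d, hd, rfl⟩ := hu
      obtain ⟨c, rfl⟩ := Submodule.mem_span_singleton.1 hs
      have : z = y + zext blk k M' h d + c • (zext blk k M' h t + Pi.single i 1) := by
        rw [← hw, add_assoc, hus, vsub_eq_sub, add_sub_cancel]
      rw [this]
      exact lift_mem blk Y k M' h i hi hb y B hyB hBS d hd c t (Or.inr ht)
    · rw [AffineSubspace.direction_mk', hdimD]
      omega
  have hBle : Module.finrank (ZMod 2) B.direction + 1 ≤ M := by
    have := Submodule.finrank_le D
    rw [Module.finrank_fintype_fun_eq_card, Fintype.card_fin, hdimD] at this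
    exact this
  omega

/-! ## The upper bound: the level part of an optimal flat -/

/-- For a size-1 block `{i}`, the `H = 0` gauge member of `y` is the slice of `y`. -/
theorem gaugeMember_zero_eq_sliceAt (blk : Fin M → Fin n) (Y : Finset (Fin M → ZMod 2)) (k : Fin n) (M' : ℕ)
    (h : (univ.filter fun i => blk i ≠ k).card = M') (i : Fin M) (hi : blk i = k) (hb : bsize blk k = 1)
    (y : Fin M → ZMod 2) :
    gaugeMember blk Y k M' h 0 (gaugeMap blk k M' h 0 y) = sliceAt blk Y k M' h i (y i) := by
  unfold gaugeMember sliceAt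
  rw [gaugeMap_zero]
  congr 1
  apply Finset.filter_congr
  intro z _
  constructor
  · intro hz
    have := congrFun hz i
    rw [blockProj_apply, blockProj_apply, if_pos hi, if_pos hi] at this
    exact this
  · intro hz
    funext j
    rw [blockProj_apply, blockProj_apply]
    split_ifs with hj
    · rw [eq_of_bsize_one blk k hb i hi j hj, hz]
    · rfl

/-- `≤`: `dim_Y(y) ≤ dim_{S_a}(π y) + 1`, and `≤ dim_{S_a}(π y)` unless `y` lifts across. -/
theorem dim_le (blk : Fin M → Fin n) (Y : Finset (Fin M → ZMod 2)) (k : Fin n) (M' : ℕ)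
    (h : (univ.filter fun i => blk i ≠ k).card = M') (i : Fin M) (hi : blk i = k) (hb : bsize blk k = 1)
    (y : Fin M → ZMod 2) (hy : y ∈ Y) :
    M + acodim M' (sliceAt blk Y k M' h i (y i)) (delBlk blk k M' h y) ≤ acodim M Y y + M' + 1 ∧
    (¬ LiftsAcross blk Y k M' h i y →
      M + acodim M' (sliceAt blk Y k M' h i (y i)) (delBlk blk k M' h y) ≤ acodim M Y y + M') := by
  obtain ⟨A, hyA, hAY, hopt⟩ := exists_optimal Y y hy
  set D := A.direction with hD
  -- the member bound with `H = 0`, read on the slice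
  have hmem := acodim_member_le blk Y k M' h 0 A y hyA hAY
  rw [gaugeMember_zero_eq_sliceAt blk Y k M' h i hi hb, gaugeMap_zero, ← hD] at hmem
  have hrank := finrank_map_gaugeMap_le blk k M' h 0 (fun x => by simp) D
  rw [gaugeMap_zero, hb] at hrank
  refine ⟨by omega, fun hnl => ?_⟩
  -- if `dim_Y(y) = dim_{S_a}(π y) + 1` we construct a lift across — contradiction
  by_contra hcon
  have hfull : Module.finrank (ZMod 2) (D.map (blockProj blk k)) = 1 := by omega
  apply hnl
  -- a crossing direction `v ∈ D` with `v i = 1`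
  have hv : ∃ v ∈ D, v i = 1 := by
    by_contra hnone
    push Not at hnone
    have h01 : ∀ c : ZMod 2, c ≠ 1 → c = 0 := by decide
    have : D.map (blockProj blk k) = ⊥ := by
      rw [Submodule.eq_bot_iff]
      rintro w ⟨v, hvD, rfl⟩
      funext j
      rw [blockProj_apply]
      split_ifs with hj
      · rw [eq_of_bsize_one blk k hb i hi j hj]; exact h01 _ (hnone v hvD)
      · rfl
    rw [this, finrank_bot] at hfull
    exact zero_ne_one hfull
  obtain ⟨v, hvD, hvi⟩ := hv
  -- the level part `K = D ⊓ ker bp` (as a submodule of `D`) and its projection `E`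
  set K : Submodule (ZMod 2) D := (LinearMap.ker (blockProj blk k)).comap D.subtype with hK
  set E : Submodule (ZMod 2) (Fin M' → ZMod 2) := K.map ((delBlk blk k M' h) ∘ₗ D.subtype) with hE
  have hrn : Module.finrank (ZMod 2) (D.map (blockProj blk k)) + Module.finrank (ZMod 2) K = Module.finrank (ZMod 2) D := by
    have := LinearMap.finrank_range_add_finrank_ker ((blockProj blk k).domRestrict D)
    rw [LinearMap.range_domRestrict, LinearMap.ker_domRestrict] at this
    exact this
  have hinj : Function.Injective (((delBlk blk k M' h) ∘ₗ D.subtype) ∘ₗ K.subtype) := by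
    rw [← LinearMap.ker_eq_bot, LinearMap.ker_eq_bot']
    intro d hd
    have hd0 : blockProj blk k ((d : D) : Fin M → ZMod 2) = 0 := LinearMap.mem_ker.mp (Submodule.mem_comap.mp d.2)
    have hπ0 : delBlk blk k M' h ((d : D) : Fin M → ZMod 2) = 0 := hd
    exact Subtype.ext (Subtype.ext (eq_zero_of_blockProj_of_delBlk blk k M' h _ hd0 hπ0))
  have hEK : Module.finrank (ZMod 2) E = Module.finrank (ZMod 2) K := by
    rw [hE, ← LinearMap.finrank_range_of_inj hinj, LinearMap.range_comp, Submodule.range_subtype]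
  -- points of `π y + E` are projections of level-`a` points of `A`; with `+ π v` projections of level-`a+1` points
  have hEpts : ∀ x ∈ (AffineSubspace.mk' (delBlk blk k M' h y) E : AffineSubspace (ZMod 2) (Fin M' → ZMod 2)),
      ∃ d : Fin M → ZMod 2, d ∈ D ∧ blockProj blk k d = 0 ∧ x = delBlk blk k M' h y + delBlk blk k M' h d := by
    intro x hx
    rw [AffineSubspace.mem_mk', hE, Submodule.mem_map] at hx
    obtain ⟨d, hdK, hdx⟩ := hx
    refine ⟨(d : D), d.2, LinearMap.mem_ker.mp (Submodule.mem_comap.mp hdK), ?_⟩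
    have : ((delBlk blk k M' h) ∘ₗ D.subtype) d = x -ᵥ delBlk blk k M' h y := hdx
    rw [LinearMap.comp_apply, Submodule.subtype_apply, vsub_eq_sub] at this
    rw [this, add_sub_cancel]
  have hlevel : ∀ d : Fin M → ZMod 2, d ∈ D → blockProj blk k d = 0 → (y + d) i = y i := by
    intro d _ hd0
    have := congrFun hd0 i
    rw [blockProj_apply, if_pos hi, Pi.zero_apply] at this
    rw [Pi.add_apply, this, add_zero]
  refine ⟨AffineSubspace.mk' (delBlk blk k M' h y) E, AffineSubspace.self_mem_mk' _ _, ?_, ?_, delBlk blk k M' h v, ?_⟩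
  · intro x hx
    obtain ⟨d, hdD, hd0, rfl⟩ := hEpts x hx
    rw [mem_sliceAt]
    refine ⟨y + d, ?_, hlevel d hdD hd0, by rw [map_add]⟩
    have := hAY _ (AffineSubspace.vadd_mem_of_mem_direction hdD hyA)
    rwa [vadd_eq_add, add_comm] at this
  · rw [AffineSubspace.direction_mk', hEK]
    omega
  · intro x hx
    obtain ⟨d, hdD, hd0, rfl⟩ := hEpts x hx
    rw [mem_sliceAt]
    refine ⟨y + d + v, ?_, ?_, by rw [map_add, map_add]⟩
    · have h1 := AffineSubspace.vadd_mem_of_mem_direction (D.add_mem hdD hvD) hyA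
      rw [vadd_eq_add, add_comm] at h1
      rw [add_assoc]; exact hAY _ h1
    · rw [Pi.add_apply, hlevel d hdD hd0, hvi]

/-! ## The excess formula -/

open scoped Classical in
/-- **One-coordinate excess formula** (size-1 block `{i}`, `y ∈ Y`):
`dim_Y(y) = dim_{S_{y i}}(π y) + [y lifts across]`, with `dim = ambient − acodim`. -/
theorem dim_eq_sliceDim_add_excess (blk : Fin M → Fin n) (Y : Finset (Fin M → ZMod 2)) (k : Fin n) (M' : ℕ)
    (h : (univ.filter fun i => blk i ≠ k).card = M') (i : Fin M) (hi : blk i = k) (hb : bsize blk k = 1)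
    (y : Fin M → ZMod 2) (hy : y ∈ Y) :
    ((M : ℤ) - (acodim M Y y : ℤ)) =
      ((M' : ℤ) - (acodim M' (sliceAt blk Y k M' h i (y i)) (delBlk blk k M' h y) : ℤ)) +
        (if LiftsAcross blk Y k M' h i y then 1 else 0) := by
  obtain ⟨hle1, hle0⟩ := dim_le blk Y k M' h i hi hb y hy
  -- an optimal flat of the slice through `π y`
  have hys : delBlk blk k M' h y ∈ sliceAt blk Y k M' h i (y i) := (mem_sliceAt blk Y k M' h i _ _).2 ⟨y, hy, rfl, rfl⟩
  obtain ⟨B, hyB, hBS, hBopt⟩ := exists_optimal (M := M') (sliceAt blk Y k M' h i (y i)) _ hys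
  have hge0 := dim_ge_flat blk Y k M' h i hi hb y B hyB hBS
  split_ifs with hl
  · obtain ⟨B', hyB', hB'S, hB'opt, t, ht⟩ := hl
    have hge1 := dim_ge_flat_translate blk Y k M' h i hi hb y B' hyB' hB'S t ht
    omega
  · have := hle0 hl
    omega

end Summit.PneNP.PneNP.Theorems.ClusCoordExcess
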